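import Mathlib.Data.Nat.Choose.Basic
import Mathlib.Algebra.BigOperators.Intervals
import Mathlib.Algebra.Order.BigOperators.Group.Finset
import Mathlib.Tactic
import Summits.CriticalPhenomena.PercolationContinuityZ3.Theorems.PercNearOneGluingNoHeavyLowerTailUWin
import Summits.CriticalPhenomena.PercolationContinuityZ3.Theorems.PercNearOneGluingNoHeavyLowerTailULC
import HarnessLib

/-!
# THEOREM U: CONJECTURE U for all parameters and all symmetric unimodal tilts

Support file for the Sahi / Conjecture-P programme of route `PercNearOneGluingNoHeavy`
(`--supports stmt-CriticalPhenomena-4575`, prover prim-l12-p5 gen 28; proof note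
`prim-l12-p5/U-PROOF-g28.md`).  No definitions, no named facts, no sorries.

* `u_all` (**THEOREM U**) : for `N = M₁+M₂+L` fair coins, `2K + j = N`, `κ ≥ 0` with
  `κ N(N-1) ≥ M₁M₂(N - (N-2K)²)` (i.e. `κ ≥ M₁M₂(N-j²)₊/(N(N-1))`, the constant of CONJECTURE U), and ANY
  symmetric unimodal weights `w₁, w₂ ≥ 0` on the two blocks:
  `0 ≤ ∑ C(M₁,x₁)w₁(x₁) C(M₂,x₂)w₂(x₂) C(L,K-x₁-x₂) (κ + (2x₁-M₁)(2x₂-M₂))`, i.e. `E_w[d₁d₂] ≥ -κ`.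
  This is the statement of `ULCKappa.u_lc_kappa` WITHOUT the log-concavity hypothesis `hlc`: CONJECTURE U
  (OMEGA1-g27 §5.6) holds unconditionally, hence the tilted TEST(j) inequality for every `j`.
Proof: Abel summation on block 1 (`Shells.abel_window`) reduces to centred windows on block 1, which is
`UWin.u_win` (the reduction of note §1 built on Lemma B1 `LambdaMono.lam_step`, Lemma B2 `CoreBlock.Mo_upper`,
and the buffer-free Proposition Z `UZero.propZ`, itself built on the one-block inequality `OneBlock.one_block`
whose core is the valley shape of the pair values, `ThetaConcave.D_step`).
-/

namespace Summit.CriticalPhenomena.PercolationContinuityZ3.Theorems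

namespace UAll

open Finset

/-- **THEOREM U (CONJECTURE U, all parameters).**  Let `N = M₁+M₂+L`, `2K + j = N`, `κ ≥ 0` with
`κ N(N-1) ≥ M₁M₂(N - (N-2K)²)`, and `w₁, w₂ ≥ 0` symmetric unimodal weights.  Then
`∑ C(M₁,x₁)w₁(x₁)C(M₂,x₂)w₂(x₂)C(L,K-x₁-x₂)(κ + (2x₁-M₁)(2x₂-M₂)) ≥ 0`, i.e. `E_w[d₁d₂] ≥ -κ`:
symmetric unimodal tilting of the two blocks never pushes the inter-block covariance below
`min(E[d₁d₂], 0) = -M₁M₂(N-j²)₊/(N(N-1))`. -/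
theorem u_all (M₁ M₂ L K j : ℕ) (hN : 2 * K + j = M₁ + M₂ + L) (κ : ℝ) (hκ : 0 ≤ κ)
    (hκ₀ : (M₁ : ℝ) * M₂ * (((M₁ + M₂ + L : ℕ) : ℝ) - (((M₁ + M₂ + L : ℕ) : ℝ) - 2 * K) ^ 2) ≤
      κ * (((M₁ + M₂ + L : ℕ) : ℝ) * (((M₁ + M₂ + L : ℕ) : ℝ) - 1)))
    (w₁ w₂ : ℕ → ℝ) (hw₁nn : ∀ x, 0 ≤ w₁ x)
    (hw₁sym : ∀ x, x ≤ M₁ → w₁ x = w₁ (M₁ - x)) (hw₁uni : ∀ x, 2 * x + 2 ≤ M₁ → w₁ x ≤ w₁ (x + 1))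
    (hw₂nn : ∀ x, 0 ≤ w₂ x)
    (hw₂sym : ∀ x, x ≤ M₂ → w₂ x = w₂ (M₂ - x)) (hw₂uni : ∀ x, 2 * x + 2 ≤ M₂ → w₂ x ≤ w₂ (x + 1)) :
    0 ≤ ∑ x₁ ∈ range (M₁ + 1), ∑ x₂ ∈ range (M₂ + 1),
        (M₁.choose x₁ : ℝ) * w₁ x₁ * ((M₂.choose x₂ : ℝ) * w₂ x₂) *
          (if x₁ + x₂ ≤ K then (L.choose (K - (x₁ + x₂)) : ℝ) else 0) *
          (κ + (2 * (x₁ : ℝ) - M₁) * (2 * (x₂ : ℝ) - M₂)) := by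
  -- degenerate blocks: M₁ = 0 or M₂ = 0 makes every term nonnegative (d₁ = 0 or d₂ = 0)
  rcases Nat.eq_zero_or_pos M₁ with hM₁ | hM₁
  · subst hM₁
    refine sum_nonneg fun x₁ hx₁ => sum_nonneg fun x₂ _ => ?_
    have hx : x₁ = 0 := by
      have := mem_range.mp hx₁
      omega
    subst hx
    have hg : 0 ≤ (if 0 + x₂ ≤ K then (L.choose (K - (0 + x₂)) : ℝ) else 0) := by
      split_ifs <;> positivity
    have : (κ + (2 * ((0 : ℕ) : ℝ) - ((0 : ℕ) : ℝ)) * (2 * (x₂ : ℝ) - M₂)) = κ := by simp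
    rw [this]
    exact mul_nonneg (mul_nonneg (mul_nonneg (mul_nonneg (by positivity) (hw₁nn 0))
      (mul_nonneg (by positivity) (hw₂nn x₂))) hg) hκ
  rcases Nat.eq_zero_or_pos M₂ with hM₂ | hM₂
  · subst hM₂
    refine sum_nonneg fun x₁ _ => sum_nonneg fun x₂ hx₂ => ?_
    have hx : x₂ = 0 := by
      have := mem_range.mp hx₂
      omega
    subst hx
    have hg : 0 ≤ (if x₁ + 0 ≤ K then (L.choose (K - (x₁ + 0)) : ℝ) else 0) := by
      split_ifs <;> positivity
    have : (κ + (2 * (x₁ : ℝ) - M₁) * (2 * ((0 : ℕ) : ℝ) - ((0 : ℕ) : ℝ))) = κ := by simp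
    rw [this]
    exact mul_nonneg (mul_nonneg (mul_nonneg (mul_nonneg (by positivity) (hw₁nn x₁))
      (mul_nonneg (by positivity) (hw₂nn 0))) hg) hκ
  -- j as a real
  have hj : (((M₁ + M₂ + L : ℕ) : ℝ) - 2 * K) = (j : ℝ) := by
    have : ((2 * K + j : ℕ) : ℝ) = ((M₁ + M₂ + L : ℕ) : ℝ) := by rw [hN]
    push_cast at this ⊢
    linarith
  rw [hj] at hκ₀
  -- sum over block 2 ∪ buffer first: T = ∑_{x₁} C(M₁,x₁) w₁(x₁) Φ(x₁)
  rw [ULC.triple_comm, ULC.outer_form M₂ M₁ L K κ w₂ w₁]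
  -- Abel summation on block 1: it suffices to treat centred windows, which is `UWin.u_win`
  set Φ : ℕ → ℝ := fun x₁ => if x₁ ≤ K then
      κ * (∑ x ∈ range (M₂ + 1), (M₂.choose x : ℝ) *
          (if x ≤ K - x₁ then (L.choose (K - x₁ - x) : ℝ) else 0) * w₂ x) +
      (2 * (x₁ : ℝ) - M₁) * (∑ x ∈ range (M₂ + 1), (M₂.choose x : ℝ) *
          (if x ≤ K - x₁ then (L.choose (K - x₁ - x) : ℝ) else 0) * w₂ x * (2 * (x : ℝ) - M₂))
    else 0 with hΦ
  have hW : ∀ i, 0 ≤ ∑ x ∈ range (M₁ + 1), (if i ≤ x ∧ x ≤ M₁ - i then (M₁.choose x : ℝ) * Φ x else 0) :=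
    fun i => UWin.u_win M₁ M₂ L K j i hN hM₁ hM₂ κ hκ hκ₀ w₂ hw₂nn hw₂sym hw₂uni
  have h := Shells.abel_window M₁ (fun x => (M₁.choose x : ℝ) * Φ x) hW (M₁ + 1) 0 (by omega) w₁
    (fun x _ _ => hw₁nn x) hw₁sym hw₁uni
  have e : ∑ x ∈ range (M₁ + 1), (if 0 ≤ x ∧ x ≤ M₁ - 0 then (M₁.choose x : ℝ) * Φ x * w₁ x else 0) =
      ∑ x ∈ range (M₁ + 1), (M₁.choose x : ℝ) * w₁ x * Φ x := by
    refine sum_congr rfl fun x hx => ?_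
    have : x ≤ M₁ := by
      have := mem_range.mp hx
      omega
    rw [if_pos ⟨Nat.zero_le x, by omega⟩]
    ring
  rw [e] at h
  exact h

end UAll

end Summit.CriticalPhenomena.PercolationContinuityZ3.Theorems
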